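import Summits.Ventures.HodgeRepro2.T5RecordJointToyInertPlaces
import Summits.Ventures.HodgeRepro2.T5CyclotomicSevenHeckeCommutative
import Mathlib.NumberTheory.LSeries.PrimesInAP

/-!
# Joint consistency at infinitely many places of `ℚ(i)`

Tier-5 support N3 / §G-N4.2 (seat p3, gen 87). The `ℚ(i)` companion of file 360: by Dirichlet (Mathlib's
`Nat.infinite_setOf_prime_and_eq_mod`) the primes `p ≡ 3 (mod 4)` are infinite, `p ↦ vPrime L p h2` is injective
(`N(vPrime) = p`, file 259), and at every such place the joint statement of file 356 holds (file 358's
`joint_four_inert`). Hence: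

* `infinite_setOf_prime_and_orderOf_eq_two` — infinitely many primes of order `2` modulo `4`;
* `vPrimeOf` — the inert places of `ℚ(i)⁺ = ℚ` indexed by those primes; `vPrimeOf_injective`;
* **`infinite_setOf_joint_four`** — the set of places `v` of `ℚ(i)⁺` above a prime `p ≡ 3 (mod 4)`, staying prime in
  `ℚ(i)` (`v 𝓞_L = w`), at which the lattice-model data for `diag(1, 1, −1)` over `vRat p` AND the unramified spectrum
  of the record's pair (Satake parameter `α · p⁻²`) hold, is INFINITE.

The `LiesOver` instances are bound by explicit terms in the predicate and passed explicitly in the proof (annex §101(b)).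
§8(d): uses an L-value-free non-vanishing device: NO.
-/

open Matrix NumberField NumberField.IsCMField IsDedekindDomain IsDedekindDomain.HeightOneSpectrum Module
  MulAction
open scoped TensorProduct Pointwise
open Summit.Ventures.HodgeRepro2.T5UnitaryGroupForm Summit.Ventures.HodgeRepro2.T5UnitaryHeckeAdjoint
  Summit.Ventures.HodgeRepro2.T5HeckePermutationModule Summit.Ventures.HodgeRepro2.LevelPositivity
  Summit.Ventures.HodgeRepro2.T5LevelIdempotent Summit.Ventures.HodgeRepro2.T5StarOfInvolution
  Summit.Ventures.HodgeRepro2.T5FinitePlaceCM Summit.Ventures.HodgeRepro2.T5NonSplitPlaceUnitaryGroup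
  Summit.Ventures.HodgeRepro2.T5RecordHyperspecial Summit.Ventures.HodgeRepro2.T5GlobalLatticeAlmostAll
  Summit.Ventures.HodgeRepro2.T5HermitianThreeElements Summit.Ventures.HodgeRepro2.T5GaloisCartanThree
  Summit.Ventures.HodgeRepro2.T5InertDegreeGalois Summit.Ventures.HodgeRepro2.T5InertPlaceCompletion
  Summit.Ventures.HodgeRepro2.T5InertDegreeAdicCompletion Summit.Ventures.HodgeRepro2.T5InertSatakeTransform
  Summit.Ventures.HodgeRepro2.T5InertSatakeTransformCompletion Summit.Ventures.HodgeRepro2.T5InertUnipotentResidue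
  Summit.Ventures.HodgeRepro2.T5InertSphericalSubquotient Summit.Ventures.HodgeRepro2.T5RecordSatakeCell
  Summit.Ventures.HodgeRepro2.T5SplitPlaceUnitaryGroup Summit.Ventures.HodgeRepro2.T5FinitePlaceNormIndex
  Summit.Ventures.HodgeRepro2.T5HermitianLocalIsotropyN3 Summit.Ventures.HodgeRepro2.T5FinitePlaceSplitClassification
  Summit.Ventures.HodgeRepro2.T5InertDegreeCompletion Summit.Ventures.HodgeRepro2.T5InertPlaceCompletionCells
  Summit.Ventures.HodgeRepro2.T5RecordSatake Summit.Ventures.HodgeRepro2.T5CartanCellsDistinct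
  Summit.Ventures.HodgeRepro2.T5RecordSatakeInert Summit.Ventures.HodgeRepro2.T5InertGlobalPrime
  Summit.Ventures.HodgeRepro2.T5CMFieldSquareDatum Summit.Ventures.HodgeRepro2.T5RecordSatakeDegree
  Summit.Ventures.HodgeRepro2.T5RecordSatakeDegreeIntrinsic Summit.Ventures.HodgeRepro2.T5RecordSphericalSpectrum
  Summit.Ventures.HodgeRepro2.T5RecordSphericalSpectrumIntrinsic Summit.Ventures.HodgeRepro2.T5RecordSatakeToy
  Summit.Ventures.HodgeRepro2.T5RecordSphericalSpectrumDatumFree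
  Summit.Ventures.HodgeRepro2.T5AdditiveConductor Summit.Ventures.HodgeRepro2.T5UnitaryGroupIsometry
  Summit.Ventures.HodgeRepro2.T5ConductorDualLattice Summit.Ventures.HodgeRepro2.T5ConductorDualLatticeSplit
  Summit.Ventures.HodgeRepro2.T5SplitHermitianClass Summit.Ventures.HodgeRepro2.T5RecordLatticeModelOutsideDiscriminant
  Summit.Ventures.HodgeRepro2.T5RecordLatticeModelSeven Summit.Ventures.HodgeRepro2.T5RecordJointOutsideDiscriminant
  Summit.Ventures.HodgeRepro2.T5RationalPlace Summit.Ventures.HodgeRepro2.T5ConductorZeroCharacter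
  Summit.Ventures.HodgeRepro2.T5CyclotomicSevenHeckeCommutative Summit.Ventures.HodgeRepro2.T5RecordJointToyInertPlaces
  Summit.Ventures.HodgeRepro2.T5CyclotomicFourInertPrime Summit.Ventures.HodgeRepro2.T5RecordSatakeInertToy
  Summit.Ventures.HodgeRepro2.T5CMCensusToy

namespace Summit.Ventures.HodgeRepro2.T5RecordJointFourInfinitelyMany

universe uV

section Dirichlet

/-- **Infinitely many primes of order `2` modulo `4`** (Dirichlet for the class of `3`). -/
theorem infinite_setOf_prime_and_orderOf_eq_two : {p : ℕ | p.Prime ∧ orderOf (p : ZMod (2 ^ 2)) = 2}.Infinite := by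
  have hu : IsUnit ((3 : ℕ) : ZMod (2 ^ 2)) := ⟨ZMod.unitOfCoprime 3 (by norm_num), rfl⟩
  refine (Nat.infinite_setOf_prime_and_eq_mod hu).mono ?_
  intro p hp
  refine ⟨hp.1, ?_⟩
  rw [hp.2]
  exact orderOf_natCast_three_zmod_four

end Dirichlet

section Four

variable (L : Type*) [Field L] [CharZero L] [IsCyclotomicExtension {2 ^ 2} ℚ L]
variable (k : Type*) [Field k] [CharZero k] [IsAlgClosed k]

/-- The inert places `(p)` of `ℚ(i)⁺ = ℚ`, indexed by the primes of order `2` modulo `4`. -/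
noncomputable def vPrimeOf (p : {p : ℕ // p.Prime ∧ orderOf (p : ZMod (2 ^ 2)) = 2}) :
    HeightOneSpectrum (𝓞 (maximalRealSubfield L)) :=
  vPrime L p.1 (hp := ⟨p.2.1⟩) p.2.2

/-- Distinct primes give distinct inert places (`N(vPrime p) = p`). -/
theorem vPrimeOf_injective :
    letI := numberField L; letI := isCMField_four L
    Function.Injective (vPrimeOf L) := by
  letI := numberField L
  letI := isCMField_four L
  intro p q h
  have hp := absNorm_vPrime L p.1 (hp := ⟨p.2.1⟩) p.2.2
  have hq := absNorm_vPrime L q.1 (hp := ⟨q.2.1⟩) q.2.2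
  have h' : (vPrimeOf L p).asIdeal = (vPrimeOf L q).asIdeal := by rw [h]
  exact Subtype.ext (by rw [← hp, ← hq]; exact h'.symm ▸ rfl)

/-- **AT INFINITELY MANY PLACES OF `ℚ(i)⁺` THE JOINT STATEMENT HOLDS**: the set of places `v` above a prime
`p ≡ 3 (mod 4)`, staying prime (`v 𝓞_L = w`), at which the lattice-model data for `diag(1, 1, −1)` over `vRat p` AND
the unramified spectrum of the record's pair (Satake parameter `α · N(v)⁻² = α · p⁻²`) hold, is infinite. -/
theorem infinite_setOf_joint_four :
    letI := numberField L; letI := isCMField_four L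
    {v : HeightOneSpectrum (𝓞 (maximalRealSubfield L)) |
      ∃ (p : ℕ) (hp : Fact p.Prime) (_h2 : orderOf (p : ZMod (2 ^ 2)) = 2) (hmem : (p : 𝓞 (maximalRealSubfield L)) ∈ v.asIdeal)
        (w : HeightOneSpectrum (𝓞 L))
        (hmap : Ideal.map (algebraMap (𝓞 (maximalRealSubfield L)) (𝓞 L)) v.asIdeal = w.asIdeal),
        letI : v.asIdeal.LiesOver (@vRat p hp).asIdeal := @liesOver_vRat_of_mem p hp _ _ _ v hmem
        letI := liesOver_of_map_eq L v w hmap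
        ((∃ ψ : AddChar ((@vRat p hp).adicCompletion ℚ) Circle, Continuous ψ ∧ (∃ y, ψ y ≠ 1) ∧
          conductorExp ψ (Valued.v : Valuation ((@vRat p hp).adicCompletion ℚ) (WithZero (Multiplicative ℤ))) = 0 ∧
          conductorExp (ψ.compAddMonoidHom
            (Algebra.trace ((@vRat p hp).adicCompletion ℚ) (v.adicCompletion (maximalRealSubfield L))).toAddMonoidHom)
            (Valued.v : Valuation (v.adicCompletion (maximalRealSubfield L)) (WithZero (Multiplicative ℤ))) = 0) ∧
        ∀ (ψ : AddChar ((@vRat p hp).adicCompletion ℚ) Circle), Continuous ψ → (∃ y, ψ y ≠ 1) →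
          conductorExp ψ (Valued.v : Valuation ((@vRat p hp).adicCompletion ℚ) (WithZero (Multiplicative ℤ))) = 0 →
          ∀ (w' : HeightOneSpectrum (𝓞 L)) [w'.asIdeal.LiesOver v.asIdeal],
            v.asIdeal.ramificationIdx' w'.asIdeal = 1 ∧
            conductorExp (recordChar L (@vRat p hp) v w' ψ)
              (Valued.v : Valuation (w'.adicCompletion L) (WithZero (Multiplicative ℤ))) = 0 ∧
            (∀ x : w'.adicCompletion L,
              (∀ y : w'.adicCompletion L, Valued.v y ≤ 1 → recordChar L (@vRat p hp) v w' ψ (x * y) = 1) ↔ Valued.v x ≤ 1) ∧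
            (∀ [StarRing (w'.adicCompletion L)],
              (∀ z : w'.adicCompletion L, IsLocalization.IsInteger (w'.adicCompletionIntegers L) z →
                IsLocalization.IsInteger (w'.adicCompletionIntegers L) (star z)) →
              ∀ x : Fin 3 → w'.adicCompletion L,
                (∀ y ∈ stdLattice (w'.adicCompletionIntegers L),
                  recordChar L (@vRat p hp) v w' ψ
                    (sesqForm (((algebraMap (𝓞 L) L).mapMatrix (Matrix.diagonal ![1, 1, -1])).map (algebraMap L (w'.adicCompletion L))) x y) = 1) ↔
                  x ∈ stdLattice (w'.adicCompletionIntegers L)) ∧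
            (letI := swapStarRing (w'.adicCompletion L)
              ∀ x : Fin 3 → w'.adicCompletion L × w'.adicCompletion L,
                (∀ y : Fin 3 → w'.adicCompletion L × w'.adicCompletion L,
                  (∀ i, Valued.v (y i).1 ≤ 1 ∧ Valued.v (y i).2 ≤ 1) →
                  recordChar L (@vRat p hp) v w' ψ
                      (sesqForm (pairMatrix (((algebraMap (𝓞 L) L).mapMatrix (Matrix.diagonal ![1, 1, -1])).map (algebraMap L (w'.adicCompletion L)))
                        (((algebraMap (𝓞 L) L).mapMatrix (Matrix.diagonal ![1, 1, -1])).map (algebraMap L (w'.adicCompletion L)))ᵀ) x y).1 *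
                    recordChar L (@vRat p hp) v w' ψ
                      (sesqForm (pairMatrix (((algebraMap (𝓞 L) L).mapMatrix (Matrix.diagonal ![1, 1, -1])).map (algebraMap L (w'.adicCompletion L)))
                        (((algebraMap (𝓞 L) L).mapMatrix (Matrix.diagonal ![1, 1, -1])).map (algebraMap L (w'.adicCompletion L)))ᵀ) x y).2 = 1) ↔
                  ∀ i, Valued.v (x i).1 ≤ 1 ∧ Valued.v (x i).2 ≤ 1)) ∧
        (∃ (θ : maximalRealSubfield L) (y : L) (hθ : algebraMap (maximalRealSubfield L) L θ = y ^ 2)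
          (hy : complexConj L y ≠ y) (r : ℕ) (l : Fin r → 𝓞 L)
          (_hl : Submodule.span (𝓞 (maximalRealSubfield L)) (Set.range l) = ⊤),
          letI := tensorStarRing L v
          letI := starRingOfQuadratic (finrank_eq_two L v w hθ hy (not_isSquare_of_staysPrime L v w hθ hy hmap))
            (localConj v w hθ.symm (span_pair_eq_top L hy) (not_isSquare_of_staysPrime L v w hθ hy hmap) (complexConj L))
            (localConj_ne_one v w hθ.symm (span_pair_eq_top L hy) (not_isSquare_of_staysPrime L v w hθ hy hmap)
              (complexConj L) (complexConj_apply_eq_neg L hθ hy))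
          haveI := isDiscreteValuationRing_integralClosure_adicCompletion v w
          haveI := finite_residueField_integralClosure_adicCompletion v w
          haveI : IsFractionRing (integralClosure (v.adicCompletionIntegers (maximalRealSubfield L)) (w.adicCompletion L))
            (w.adicCompletion L) :=
            integralClosure.isFractionRing_of_finite_extension (v.adicCompletion (maximalRealSubfield L))
              (w.adicCompletion L)
          ∃ (u₀ : (v.adicCompletionIntegers (maximalRealSubfield L))ˣ)
            (Φ : ↥(formUnitaryGroup (J3 (algebraMap (v.adicCompletionIntegers (maximalRealSubfield L))
              (w.adicCompletion L) (u₀ : v.adicCompletionIntegers (maximalRealSubfield L))))) ≃*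
              ↥(formUnitaryGroup (tensorGram L v (gramToy L))))
            (ϖ' : integralClosure (v.adicCompletionIntegers (maximalRealSubfield L)) (w.adicCompletion L))
            (hϖ' : Irreducible ϖ')
            (hs' : star (algebraMap (integralClosure (v.adicCompletionIntegers (maximalRealSubfield L))
              (w.adicCompletion L)) (w.adicCompletion L) ϖ') =
                algebraMap (integralClosure (v.adicCompletionIntegers (maximalRealSubfield L)) (w.adicCompletion L))
                  (w.adicCompletion L) ϖ'),
            (∀ g, g ∈ hyperspecialSubgroup
                (integralClosure (v.adicCompletionIntegers (maximalRealSubfield L)) (w.adicCompletion L))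
                (J3 (algebraMap (v.adicCompletionIntegers (maximalRealSubfield L)) (w.adicCompletion L)
                  (u₀ : v.adicCompletionIntegers (maximalRealSubfield L)))) ↔ Φ g ∈ recordHyperspecial L v l (gramToy L)) ∧
            ∀ {V : Type uV} [AddCommGroup V] [Module k V]
              (ρ : Representation k (↥(formUnitaryGroup (tensorGram L v (gramToy L)))) V) [ρ.IsIrreducible],
              KFinite ρ (recordHyperspecial L v l (gramToy L)) →
              ∀ [FiniteDimensional k (invariants ρ (recordHyperspecial L v l (gramToy L)))],
              invariants ρ (recordHyperspecial L v l (gramToy L)) ≠ ⊥ →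
              ∃ α : k, α ≠ 0 ∧ Nonempty (ρ.Equiv (comp Φ.symm
                (inertSphericalQuot
                  (hstar_of_star_eq (localConj v w hθ.symm (span_pair_eq_top L hy)
                    (not_isSquare_of_staysPrime L v w hθ hy hmap) (complexConj L))
                    (fun x => by rw [star_p8_eq_star L v w hθ hy (not_isSquare_of_staysPrime L v w hθ hy hmap)]; rfl))
                  (algebraMap (v.adicCompletionIntegers (maximalRealSubfield L)) (w.adicCompletion L)
                    (u₀ : v.adicCompletionIntegers (maximalRealSubfield L)))
                  (star_algebraMap_of_star_eq (localConj v w hθ.symm (span_pair_eq_top L hy)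
                    (not_isSquare_of_staysPrime L v w hθ hy hmap) (complexConj L))
                    (fun x => by rw [star_p8_eq_star L v w hθ hy (not_isSquare_of_staysPrime L v w hθ hy hmap)]; rfl)
                    (u₀ : v.adicCompletionIntegers (maximalRealSubfield L)))
                  (algebraMap_unit_ne_zero (F := v.adicCompletion (maximalRealSubfield L)) u₀)
                  (isInteger_algebraMap (u₀ : v.adicCompletionIntegers (maximalRealSubfield L)))
                  (isInteger_algebraMap_unit_inv u₀) hϖ' hs' k (α * ((Ideal.absNorm v.asIdeal : k) ^ 2)⁻¹)))))}.Infinite := by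
  letI := numberField L
  letI := isCMField_four L
  haveI : Infinite {p : ℕ // p.Prime ∧ orderOf (p : ZMod (2 ^ 2)) = 2} :=
    infinite_setOf_prime_and_orderOf_eq_two.to_subtype
  refine Set.infinite_of_injective_forall_mem (vPrimeOf_injective L) fun p => ?_
  haveI hp : Fact p.1.Prime := ⟨p.2.1⟩
  have hmem : (p.1 : 𝓞 (maximalRealSubfield L)) ∈ (vPrimeOf L p).asIdeal := natCast_mem_vPrime L p.1 p.2.2
  have hmap : Ideal.map (algebraMap (𝓞 (maximalRealSubfield L)) (𝓞 L)) (vPrimeOf L p).asIdeal =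
      (wPrime L p.1 p.2.2).asIdeal := map_vPrime L p.1 p.2.2
  have h2 : (2 : 𝓞 (maximalRealSubfield L)) ∉ (vPrimeOf L p).asIdeal := two_notMem_vPrime L p.1 p.2.2
  exact ⟨p.1, hp, p.2.2, hmem, wPrime L p.1 p.2.2, hmap,
    @joint_outside_discriminant_of_staysPrime L _ (numberField L) (isCMField_four L) (@vRat p.1 hp) (vPrimeOf L p)
      (@liesOver_vRat_of_mem p.1 hp _ _ _ (vPrimeOf L p) hmem)
      (@discr_four_notMem L _ _ _ (numberField L) (vPrimeOf L p) h2)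
      (wPrime L p.1 p.2.2) (@liesOver_of_map_eq L _ (numberField L) (vPrimeOf L p) (wPrime L p.1 p.2.2) hmap) hmap
      k _ _ _⟩

end Four

end Summit.Ventures.HodgeRepro2.T5RecordJointFourInfinitelyMany
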